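import Summits.CriticalPhenomena.SAWScalingLimit.Theorems.IsingBoundaryRatio.Negative.IsingBoundaryRatioNesting
import Literature.Probability.RandomPlanarGeometry.SAWScalingLimitFamily
import Literature.Probability.LatticeModels.DiluteLoopModelSAW
import Literature.Probability.LatticeModels.MeshApproximatesPolyomino
import Literature.Probability.LatticeModels.ModifiedSimonInequality

/-!
# Line `fk-anchor-transfer`: the REPAIRED arm-origin forgetting and the honest stub 1e
(cycle-c1 lead `prover-line-stmt-CriticalPhenomena-10650-c1-0`, companion of
`Lines/fk_anchor_transfer_c1_armOriginRefutation.lean`)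

Lead-1's rev-4 `ArmOriginForgettingAt` is false as defined (far spins reachable only through vertices
outside the finite volume make `τ = 0`, kernel-checked in the companion file). This file states the
REPAIRED form `ArmOriginForgettingAt'` — identical except that the four reachability hypotheses ask for
walks WITH SUPPORT INSIDE the finite volume — and proves, sorry-free:

* `τ_pos_of_walk` — under the repaired hypotheses all four `τ`'s are `> 0` (GKS I via the
  high-temperature expansion: `hteSum_pos_of_path`), so no `x / 0` junk remains;
* `localAgreement_self`, `localAgreement_subdomain` — the two finite-volume graphs of the crux,
  `(Ω_δ, meshDomainFinset D δ)` and `(Ω'_δ, meshDomainFinset D' δ)` for the hull subdomain `D' ⊆ D`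
  agreeing with `D` in `B(D.pt i, ε)`, AGREE LOCALLY with `Ω_δ` in `B(D.pt i, ε/2)` once `δ < ε/2` and
  the mesh domains are nested (an `Ω_δ`-edge at a site of `Ω'_δ` inside the half-ball has its closed
  segment in `closure D ∩ B(D.pt i, ε) ⊆ closure D'`, its far end in `D ∩ B = D' ∩ B`, and a
  mesh-neighbour of a site of a maximal component lies in that component);
* `anchorLocality_of_armOriginForgetting'` — **the honest stub 1e**: the repaired arm-origin
  forgetting at both marked points implies `AnchorLocality` (lead-0/lead-1's registered statement,
  verbatim), the crux's `Ω'_δ`-reachability hypotheses supplying in-volume walks.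

So adopting `ArmOriginForgettingAt'` in place of `ArmOriginForgettingAt` keeps lead-1's composition
intact: 1e is landed here in repaired form, and the heart 1c should conclude `ArmOriginForgettingAt'`.
-/

noncomputable section

open scoped Classical Topology symmDiff
open Filter Set Metric
open Literature.Probability.LatticeModels Literature.Probability.RandomPlanarGeometry
open Summit.CriticalPhenomena.SAWScalingLimit.Theorems.IsingBoundaryRatio.Negative

namespace Summit.CriticalPhenomena.SAWScalingLimit.Cruxes.IsingBoundaryRatio.FkAnchorTransferC1Repair

/-! ### Definitions: lead-1's `LocalAgreement`, `τ` (verbatim) and the REPAIRED forgetting -/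

/-- (verbatim, rev 4) Local agreement of `(G, Λ)` with `Ω_δ` inside `B(p, ε)`. -/
def LocalAgreement (Ω : Set ℂ) (p : ℂ) (ε δ : ℝ) (G : SimpleGraph (Site 2))
    (Λ : Finset (Site 2)) : Prop :=
  ∀ w ∈ Λ, meshPoint δ w ∈ Metric.ball p ε →
    ∀ v : Site 2, (G.Adj w v ↔ (discreteDomainGraph Ω δ).Adj w v) ∧
      ((discreteDomainGraph Ω δ).Adj w v → v ∈ Λ)

/-- (verbatim, rev 4) The free critical Ising two-point function of the finite volume `(G, Λ)`. -/
def τ (G : SimpleGraph (Site 2)) [G.LocallyFinite] (Λ : Finset (Site 2)) (x y : Site 2) : ℝ :=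
  isingTwoPoint G Λ criticalBetaTwo 0 .free x y

/-- **Arm-origin forgetting at `p`, REPAIRED**: as lead-1's rev-4 `ArmOriginForgettingAt`, but the
anchors and far spins are joined by walks of `G` WITH SUPPORT IN `Λ` (in-volume connectivity — what
the Edwards–Sokal reading `τ = φ⁰_{(G|_Λ)}[x ↔ y]` needs, and what makes the four `τ`'s positive). -/
def ArmOriginForgettingAt' (Ω : Set ℂ) (p : ℂ) : Prop :=
  ∀ (ε c η : ℝ), 0 < ε → 0 < c → 0 < η → ∃ r : ℝ, 0 < r ∧ ∀ᶠ δ in 𝓝[>] (0 : ℝ),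
    ∀ (G₁ : SimpleGraph (Site 2)) [G₁.LocallyFinite] (G₂ : SimpleGraph (Site 2)) [G₂.LocallyFinite]
      (Λ₁ Λ₂ : Finset (Site 2)) (x x' y₁ y₂ : Site 2),
      LocalAgreement Ω p ε δ G₁ Λ₁ → LocalAgreement Ω p ε δ G₂ Λ₂ →
      x ∈ Λ₁ → x ∈ Λ₂ → x' ∈ Λ₁ → x' ∈ Λ₂ → y₁ ∈ Λ₁ → y₂ ∈ Λ₂ →
      dist (meshPoint δ x) p < r → dist (meshPoint δ x') p < r →
      c ≤ dist (meshPoint δ y₁) p → c ≤ dist (meshPoint δ y₂) p →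
      (∃ w : G₁.Walk x y₁, ∀ v ∈ w.support, v ∈ Λ₁) → (∃ w : G₁.Walk x' y₁, ∀ v ∈ w.support, v ∈ Λ₁) →
      (∃ w : G₂.Walk x y₂, ∀ v ∈ w.support, v ∈ Λ₂) → (∃ w : G₂.Walk x' y₂, ∀ v ∈ w.support, v ∈ Λ₂) →
      |τ G₁ Λ₁ x y₁ / τ G₁ Λ₁ x' y₁ / (τ G₂ Λ₂ x y₂ / τ G₂ Λ₂ x' y₂) - 1| < η

/-- Repaired arm-origin forgetting at both marked prime ends of every Dobrushin domain. -/
def ArmOriginForgetting' : Prop :=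
  ∀ (D : DobrushinDomain) (i : Fin 2), ArmOriginForgettingAt' D.carrier (D.pt i)

/-! ### No junk: in-volume walks make `τ` positive -/

/-- GKS I for the finite volume `(G, Λ)`: an in-volume walk from `x` to `y` gives `0 < τ G Λ x y`
(high-temperature expansion + path witness, `hteSum_pos_of_path`). -/
theorem τ_pos_of_walk (G : SimpleGraph (Site 2)) [G.LocallyFinite] (Λ : Finset (Site 2))
    {x y : Site 2} (w : G.Walk x y) (hw : ∀ v ∈ w.support, v ∈ Λ) : 0 < τ G Λ x y := by
  by_cases hne : x = y
  · subst hne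
    unfold τ
    rw [isingTwoPoint_self]
    exact one_pos
  have hx : x ∈ Λ := hw _ w.start_mem_support
  have hy : y ∈ Λ := hw _ w.end_mem_support
  unfold τ
  rw [isingTwoPoint_free_eq_hteSum_div _ _ _ hx hy]
  refine div_pos ?_ (hteSum_empty_pos _ _ _)
  have htanh : 0 < Real.tanh criticalBetaTwo := tanh_criticalBetaTwo_pos
  exact hteSum_pos_of_path _ _ htanh hne w.toPath w.toPath.2
    fun v hv => hw v (SimpleGraph.Walk.support_toPath_subset_support w hv)

/-! ### Local agreement of the crux's two finite-volume graphs -/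

/-- `(Ω_δ, meshDomainFinset Ω δ)` agrees locally with `Ω_δ` (everywhere). -/
theorem localAgreement_self {Ω : Set ℂ} (hΩ : Bornology.IsBounded Ω) (p : ℂ) (ε : ℝ) {δ : ℝ}
    (hδ : 0 < δ) : LocalAgreement Ω p ε δ (discreteDomainGraph Ω δ) (meshDomainFinset Ω δ) := by
  intro w _ _ v
  refine ⟨Iff.rfl, fun h => ?_⟩
  rw [← Finset.mem_coe, coe_meshDomainFinset hΩ hδ]
  exact (discreteDomainGraph_adj_iff.1 h).2.2

/-- **Local agreement of the subdomain graph**: for `D' ⊆ D` with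
`D' ∩ B(p, ε) = D ∩ B(p, ε)`, `0 < δ < ε/2` and nested mesh domains, `(Ω'_δ, meshDomainFinset D' δ)`
agrees locally with `Ω_δ` in `B(p, ε/2)`. -/
theorem localAgreement_subdomain {D D' : DobrushinDomain} {p : ℂ} {ε δ : ℝ}
    (hsub : D'.carrier ⊆ D.carrier) (hball : D'.carrier ∩ ball p ε = D.carrier ∩ ball p ε)
    (hδ : 0 < δ) (hδε : δ < ε / 2) (hnest : meshDomain D'.carrier δ ⊆ meshDomain D.carrier δ) :
    LocalAgreement D.carrier p (ε / 2) δ (discreteDomainGraph D'.carrier δ)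
      (meshDomainFinset D'.carrier δ) := by
  have hbdd' : Bornology.IsBounded D'.carrier := D.isBounded.subset hsub
  intro w hw hwball v
  rw [← Finset.mem_coe, coe_meshDomainFinset hbdd' hδ] at hw
  rw [Metric.mem_ball] at hwball
  have key : (discreteDomainGraph D.carrier δ).Adj w v → (discreteDomainGraph D'.carrier δ).Adj w v := by
    intro h
    obtain ⟨hmesh, -, hvD⟩ := discreteDomainGraph_adj_iff.1 h
    obtain ⟨hzd, hseg⟩ := meshGraph_adj_iff.1 hmesh
    -- both mesh points lie in the ball `B(p, ε)`
    have hwB : meshPoint δ w ∈ ball p ε := by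
      rw [Metric.mem_ball]; linarith
    have hvB : meshPoint δ v ∈ ball p ε := by
      rw [Metric.mem_ball]
      have h1 := Polyomino.dist_meshPoint_le_of_adj hδ.le hzd
      have h2 := dist_triangle (meshPoint δ v) (meshPoint δ w) p
      rw [dist_comm (meshPoint δ v) (meshPoint δ w)] at h2
      linarith
    -- the closed segment lies in `closure D ∩ B(p, ε) ⊆ closure D'`
    have hseg' : segment ℝ (meshPoint δ w) (meshPoint δ v) ⊆ closure D'.carrier := by
      intro z hz
      have hzB : z ∈ ball p ε := (convex_ball p ε).segment_subset hwB hvB hz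
      have hzcl : z ∈ closure D.carrier := hseg hz
      have : z ∈ closure (ball p ε ∩ D.carrier) := isOpen_ball.inter_closure ⟨hzB, hzcl⟩
      rw [inter_comm, ← hball] at this
      exact closure_mono inter_subset_left this
    have hmesh' : (meshGraph D'.carrier δ).Adj w v := meshGraph_adj_iff.2 ⟨hzd, hseg'⟩
    -- the far end is a mesh vertex of `D'`, hence in the component of `w`
    have hvD' : v ∈ meshVertices D'.carrier δ := by
      have h1 : meshPoint δ v ∈ D.carrier := meshDomain_subset_meshVertices _ _ hvD
      have h2 : meshPoint δ v ∈ D'.carrier ∩ ball p ε := by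
        rw [hball]; exact ⟨h1, hvB⟩
      exact h2.1
    have hwD' : w ∈ meshVertices D'.carrier δ := meshDomain_subset_meshVertices _ _ hw
    have hadj' : (meshVertexGraph D'.carrier δ).Adj ⟨w, hwD'⟩ ⟨v, hvD'⟩ := by
      simpa only [SimpleGraph.comap_adj, Function.Embedding.subtype_apply] using hmesh'
    have hv' : v ∈ meshDomain D'.carrier δ := mem_meshDomain_of_adj hw hadj'
    exact discreteDomainGraph_adj_iff.2 ⟨hmesh', hw, hv'⟩
  refine ⟨⟨fun h => discreteDomainGraph_mono hsub hnest h, key⟩, fun h => ?_⟩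
  rw [← Finset.mem_coe, coe_meshDomainFinset hbdd' hδ]
  exact (discreteDomainGraph_adj_iff.1 (key h)).2.2

/-! ### The honest stub 1e: repaired arm-origin forgetting ⇒ anchor locality -/

/-- **`ArmOriginForgetting' → AnchorLocality`** (lead-0/lead-1's registered `stub_anchorLocality`
statement, verbatim): apply the repaired forgetting at `D.pt i` with localisation radius `ε/2` to
`(G₁, Λ₁) = (Ω'_δ, meshDomainFinset D' δ)` and `(G₂, Λ₂) = (Ω_δ, meshDomainFinset D δ)` with the
common far spin `y δ`; the crux's `Ω'_δ`-reachability gives walks with support in `meshDomain D' δ`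
(`support_subset_meshDomain`), mapped into `Ω_δ` along `Ω'_δ ≤ Ω_δ`; `τ (Ω_δ) (meshDomainFinset Ω δ)
= T Ω δ` by `rfl`. The returned radius is `min r (c/2)` so that `x δ ≠ y δ`. -/
theorem anchorLocality_of_armOriginForgetting' (hA : ArmOriginForgetting') :
    ∀ (D D' : DobrushinDomain) (i : Fin 2) (ε : ℝ), D'.carrier ⊆ D.carrier → 0 < ε →
      D'.carrier ∩ Metric.ball (D.pt i) ε = D.carrier ∩ Metric.ball (D.pt i) ε →
      ∀ c : ℝ, 0 < c → ∀ η : ℝ, 0 < η → ∃ r : ℝ, 0 < r ∧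
        ∀ (x x' y : ℝ → Site 2),
          (∀ᶠ δ in 𝓝[>] (0 : ℝ), dist (meshPoint δ (x δ)) (D.pt i) < r) →
          (∀ᶠ δ in 𝓝[>] (0 : ℝ), dist (meshPoint δ (x' δ)) (D.pt i) < r) →
          (∀ᶠ δ in 𝓝[>] (0 : ℝ), c ≤ dist (meshPoint δ (y δ)) (D.pt i)) →
          (∀ᶠ δ in 𝓝[>] (0 : ℝ), (discreteDomainGraph D'.carrier δ).Reachable (x δ) (y δ) ∧
            (discreteDomainGraph D'.carrier δ).Reachable (x' δ) (y δ)) →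
          (∀ᶠ δ in 𝓝[>] (0 : ℝ), meshDomain D'.carrier δ ⊆ meshDomain D.carrier δ) →
          ∀ᶠ δ in 𝓝[>] (0 : ℝ),
            |T D'.carrier δ (x δ) (y δ) / T D'.carrier δ (x' δ) (y δ) /
                (T D.carrier δ (x δ) (y δ) / T D.carrier δ (x' δ) (y δ)) - 1| < η := by
  intro D D' i ε hsub hε hball c hc η hη
  obtain ⟨r, hr, hev⟩ := hA D i (ε / 2) c η (half_pos hε) hc hη
  refine ⟨min r (c / 2), lt_min hr (half_pos hc), ?_⟩
  intro x x' y hx hx' hy hreach hnest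
  filter_upwards [hev, hx, hx', hy, hreach, hnest, Ioo_mem_nhdsGT (half_pos hε)]
    with δ hP hxδ hx'δ hyδ hrδ hnδ hδ
  have hδ0 : 0 < δ := hδ.1
  have hbdd' : Bornology.IsBounded D'.carrier := D.isBounded.subset hsub
  have hxr : dist (meshPoint δ (x δ)) (D.pt i) < r := lt_of_lt_of_le hxδ (min_le_left _ _)
  have hx'r : dist (meshPoint δ (x' δ)) (D.pt i) < r := lt_of_lt_of_le hx'δ (min_le_left _ _)
  have hxy : x δ ≠ y δ := by
    intro h
    rw [h] at hxδ
    have := lt_of_lt_of_le hxδ (min_le_right _ _)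
    linarith
  have hx'y : x' δ ≠ y δ := by
    intro h
    rw [h] at hx'δ
    have := lt_of_lt_of_le hx'δ (min_le_right _ _)
    linarith
  -- memberships
  obtain ⟨hxm', hym'⟩ := mem_meshDomainFinset_of_reachable_ne hbdd' hδ0 hrδ.1 hxy
  obtain ⟨hx'm', -⟩ := mem_meshDomainFinset_of_reachable_ne hbdd' hδ0 hrδ.2 hx'y
  have hfin : ∀ v, v ∈ meshDomainFinset D'.carrier δ → v ∈ meshDomainFinset D.carrier δ := by
    intro v hv
    rw [← Finset.mem_coe, coe_meshDomainFinset hbdd' hδ0] at hv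
    rw [← Finset.mem_coe, coe_meshDomainFinset D.isBounded hδ0]
    exact hnδ hv
  -- in-volume walks
  have hmono : discreteDomainGraph D'.carrier δ ≤ discreteDomainGraph D.carrier δ :=
    discreteDomainGraph_mono hsub hnδ
  have walks : ∀ {u : Site 2}, u ∈ meshDomainFinset D'.carrier δ →
      (discreteDomainGraph D'.carrier δ).Reachable u (y δ) →
      (∃ w : (discreteDomainGraph D'.carrier δ).Walk u (y δ), ∀ v ∈ w.support, v ∈ meshDomainFinset D'.carrier δ) ∧
      (∃ w : (discreteDomainGraph D.carrier δ).Walk u (y δ), ∀ v ∈ w.support, v ∈ meshDomainFinset D.carrier δ) := by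
    intro u hu hr'
    obtain ⟨w⟩ := hr'
    have hu' : u ∈ meshDomain D'.carrier δ := by
      rw [← Finset.mem_coe, coe_meshDomainFinset hbdd' hδ0] at hu; exact hu
    have hsupp : ∀ v ∈ w.support, v ∈ meshDomainFinset D'.carrier δ := by
      intro v hv
      rw [← Finset.mem_coe, coe_meshDomainFinset hbdd' hδ0]
      exact DiluteLoopModel.support_subset_meshDomain w hu' v hv
    refine ⟨⟨w, hsupp⟩, ⟨w.map (SimpleGraph.Hom.ofLE hmono), ?_⟩⟩
    intro v hv
    rw [← Finset.mem_coe, coe_meshDomainFinset D.isBounded hδ0]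
    exact DiluteLoopModel.support_subset_meshDomain (w.map (SimpleGraph.Hom.ofLE hmono)) (hnδ hu') v hv
  obtain ⟨w₁, w₂⟩ := walks hxm' hrδ.1
  obtain ⟨w₁', w₂'⟩ := walks hx'm' hrδ.2
  have key := hP (discreteDomainGraph D'.carrier δ) (discreteDomainGraph D.carrier δ)
    (meshDomainFinset D'.carrier δ) (meshDomainFinset D.carrier δ) (x δ) (x' δ) (y δ) (y δ)
    (localAgreement_subdomain hsub hball hδ0 hδ.2 hnδ) (localAgreement_self D.isBounded _ _ hδ0)
    hxm' (hfin _ hxm') hx'm' (hfin _ hx'm') hym' (hfin _ hym') hxr hx'r hyδ hyδ w₁ w₁' w₂ w₂'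
  simpa only [τ, T] using key

end Summit.CriticalPhenomena.SAWScalingLimit.Cruxes.IsingBoundaryRatio.FkAnchorTransferC1Repair

end
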